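import Literature.NumberTheory.EllipticCurves.HeegnerPointsKolyvaginPrimaryDescentProofs
import HarnessLib

/-!
# K7t crux `UpperOffV0HSY` (item 19581): Kolyvagin's descent modulo `p^M` WITHOUT PARITY —
# the abstract count with defects (the `p = 2` twin of `KolyvaginDescent.HypothesesM`)

Route `SylvesterTwoHeegnerIndex` (cell bsd-cm, rung K7t), line `offv0-kolyvagin2` on
stmt-BirchSwinnertonDyer-19581, registered stub (f)+(g) `stub_upperOffV0_of_kolyvaginDescent_two`
(k7t-c2 g3): *(d) Kolyvagin classes at 2 → (e) reciprocity at 2 → the crux*.  The tree's abstract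
descent `Literature.NumberTheory.EllipticCurves.KolyvaginDescent.HypothesesM` (McCallum 1991 §§3–5 /
Gross 1991 §10 modulo `p^M`) carries the field `hp2 : p ≠ 2` and uses it in exactly three places:
`indep_of_eigen` / `indep_of_eigen₃` (opposite `τ`-eigenclasses are independent because `2` is
invertible) and `pow_zsmul_mem_zmultiples` (the eigen-decomposition `s = s⁺ + s⁻`).  This file redoes
the count for an ARBITRARY prime `p` — so in particular for `p = 2` — from the same displayed data,
with two honest modifications, and records the price:

* the local duality (McCallum Lemma 5.3 with Prop. 2.2) is taken WITH A DEFECT `δ`: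
  `p^a d_λ ≠ 0 ⟹ p^{M-1-a+δ} s_λ = 0` (at `p = 2` for the CM curves `y² = x³ − c` the `τ`-eigenlines of
  `E[2^M]` span a subgroup of index `2` — `…UpperOffV0EisensteinConj`, p445367 — so the Weil pairing of
  their generators has order `2^{M-1}` and Lemma 5.3 holds with `δ = 1`, not `0`);
* opposite eigenclasses need not be independent at `2` (they may share their `p`-socle); Claim A
  survives by a socle case split (`claimA_defect`: **`p^{M₀+δ} · Sel^{-ε} = 0`**, no further loss),
  Claim B survives OFF one configuration — a Kolyvagin class `c(ℓ)` sharing its socle with `x`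
  (`claimB_indep_defect`: **`p^{2M₀+2δ} s = 0`** for `s ∈ Sel^{ε}` independent of `x`, granted
  `ℤ c(ℓ) ∩ ℤ x = 0`), and in general granted ONE MORE Čebotarev instance (`hceb₁`: McCallum's Cor. 3.2
  for the eigen-family `{x, s, c(ℓ)}` with the single relation "socle of `c(ℓ)` = socle of `x`",
  prescribing `ord c(ℓ)_{λ'} = p^{k-1}`; at `2` it follows from McCallum's (2) at `2`, p447504, and
  Step B at `2`, p448442 — not assembled here) with one more `p` (`claimB_indep_defect'`:
  `p^{2M₀+2δ+1} s = 0`);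
* the eigen-decomposition costs the factor `2`: **`2 · p^{2M₀+2δ} · Sel ⊆ ℤ x`**
  (`descent_defect`, socle hypothesis) resp. **`2 · p^{2M₀+2δ+1} · Sel ⊆ ℤ x`** (`descent_defect'`).

For `p` odd and `δ = 0` this is the tree's `HypothesesM.pow_zsmul_mem_zmultiples` again (the socle
hypotheses are then automatic).  For `p = 2`, `δ = 1` it is the generic 2-adic Kolyvagin EXPONENT bound
`2^{2M₀+3}` (resp. `2^{2M₀+4}`) `· S_{2^M}(E/K) ⊆ ℤ δ_M x₀` that steps (d)(e) of the line can feed — the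
typed measure of the distance between the odd-`p` machine and the crux's SHARP order bound
`ord₂ #Ш(E_p/K)[2^∞] ≤ 2M₀` (constant `0`; no source in print: Kolyvagin's own `p = 2` statements carry
inexplicit defects, ICM 1990 Thm 5 / Math. Ann. 291 `k₀, k₃`).  NOT the crux; B14 = O12 stays open as a
class.  Pure algebra: no Galois cohomology, no named fact, no definition; the data are displayed
hypotheses with the names and shapes of the fields of `HypothesesM` (so that an instantiation at `2`
mirrors `KolyvaginDescent.exists_hypothesesM_of_leavesM`).

THIS FILE (first of three): §1 exact exponents and socles in a group killed by `p^M`; §2 the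
eigenclass / local-condition bookkeeping of the displayed data; §3 **Claim A** (`claimA_defect`) and
Prop. 10.2 (`pow_zsmul_c_eq_zero_defect`).  Steps B/C and Claim B off the socle configuration are in
`…UpperOffV0DescentDefectClaimB`; Claim B in general, the splitting and the annihilation theorems in
`…UpperOffV0DescentDefect`.
-/

noncomputable section

open scoped Classical

set_option autoImplicit false
set_option linter.dupNamespace false

namespace Summit.BirchSwinnertonDyer.BirchSwinnertonDyer.Theorems.SylvesterTwoUpper.DescentDefect

open Literature.NumberTheory.EllipticCurves.KolyvaginDescent

variable {V : Type*} [AddCommGroup V] {p M : ℕ}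

/-! ## §1 Exact exponents and socles in a group killed by `p^M` (parity-free) -/

/-- Every element of a group killed by `p^M` has an exact exponent `N ≤ M`: `p^N s = 0` and
`p^a s ≠ 0` for `a < N` (the tree's `HypothesesM.expo`, as an existence statement). [folklore] -/
theorem exists_exact_exponent (torsion : ∀ v : V, ((p : ℤ) ^ M) • v = 0) (s : V) :
    ∃ N : ℕ, N ≤ M ∧ ((p : ℤ) ^ N) • s = 0 ∧ ∀ a : ℕ, a < N → ((p : ℤ) ^ a) • s ≠ 0 := by
  have hex : ∃ a : ℕ, ((p : ℤ) ^ a) • s = 0 := ⟨M, torsion s⟩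
  exact ⟨Nat.find hex, Nat.find_min' hex (torsion s), Nat.find_spec hex,
    fun a ha ↦ Nat.find_min hex ha⟩

/-- With an exact exponent `N`, `p^a s ∈ H` and `p^{N-1} s ∉ H` force `N ≤ a`. [folklore] -/
theorem exact_exponent_le_of_mem {H : AddSubgroup V} {s : V} {N a : ℕ}
    (hmem : ((p : ℤ) ^ a) • s ∈ H) (hnot : N ≠ 0 → ((p : ℤ) ^ (N - 1)) • s ∉ H) : N ≤ a := by
  by_contra hlt
  have hlt := Nat.lt_of_not_le hlt
  exact hnot (by omega) (pow_zsmul_mem_of_le (by omega) hmem)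

/-- An integer not divisible by `p` acts invertibly on a group killed by `p^M`: membership in a
subgroup is unchanged by such a scalar. [folklore] -/
theorem unit_zsmul_mem_iff (hp : p.Prime) (torsion : ∀ v : V, ((p : ℤ) ^ M) • v = 0)
    {u : ℤ} (hu : ¬ (p : ℤ) ∣ u) (H : AddSubgroup V) (v : V) : u • v ∈ H ↔ v ∈ H := by
  refine ⟨fun h ↦ ?_, fun h ↦ H.zsmul_mem h u⟩
  obtain ⟨w, hw⟩ := exists_mul_zsmul_eq_of_not_dvd hp torsion hu
  rw [← hw v, mul_zsmul]
  exact H.zsmul_mem h w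

/-- A unit multiple of a non-zero element is non-zero. [folklore] -/
theorem unit_zsmul_ne_zero (hp : p.Prime) (torsion : ∀ v : V, ((p : ℤ) ^ M) • v = 0)
    {u : ℤ} (hu : ¬ (p : ℤ) ∣ u) {v : V} (hv : v ≠ 0) : u • v ≠ 0 := by
  intro h
  obtain ⟨w, hw⟩ := exists_mul_zsmul_eq_of_not_dvd hp torsion hu
  apply hv
  rw [← hw v, mul_zsmul, h, zsmul_zero]

/-- **The socle of a cyclic `p`-group.** If `z` has exact exponent `k ≠ 0` and `t ∈ ℤ z` is a
non-zero element killed by `p`, then `t` is a unit multiple of `p^{k-1} z`. [folklore] -/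
theorem exists_unit_zsmul_socle (hp : p.Prime) {z : V} {k : ℕ} (hk : k ≠ 0)
    (hz : ((p : ℤ) ^ k) • z = 0) (hz' : ((p : ℤ) ^ (k - 1)) • z ≠ 0) {t : V} {m : ℤ}
    (ht : t = m • z) (ht0 : t ≠ 0) (hpt : (p : ℤ) • t = 0) :
    ∃ u : ℤ, ¬ (p : ℤ) ∣ u ∧ t = u • (((p : ℤ) ^ (k - 1)) • z) := by
  -- `p^k ∣ p m`, so `p^{k-1} ∣ m`
  have h1 : ((p : ℤ) ^ k) ∣ (p : ℤ) * m := by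
    rw [← zsmul_eq_zero_iff_prime_pow_dvd hp hz hz', mul_zsmul, ← ht, hpt]
  obtain ⟨k', rfl⟩ : ∃ k', k = k' + 1 := ⟨k - 1, by omega⟩
  rw [pow_succ', Nat.add_sub_cancel] at *
  have hp0 : (p : ℤ) ≠ 0 := by exact_mod_cast hp.ne_zero
  obtain ⟨u, rfl⟩ : ((p : ℤ) ^ k') ∣ m := (mul_dvd_mul_iff_left hp0).mp h1
  refine ⟨u, fun hpu ↦ ht0 ?_, by rw [ht, mul_comm, mul_zsmul]⟩
  -- if `p ∣ u` then `p^k ∣ m` and `t = 0`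
  obtain ⟨u', rfl⟩ := hpu
  rw [ht, show (p : ℤ) ^ k' * ((p : ℤ) * u') = u' * ((p : ℤ) * (p : ℤ) ^ k') by ring, mul_zsmul,
    hz, zsmul_zero]

/-- **Non-zero subgroups of a cyclic `p`-group contain its socle.** If `s` has exact exponent
`N` and `a • s ≠ 0`, then `p^{N-1} s` is a multiple of `a • s`. [folklore] -/
theorem exists_socle_eq_zsmul (hp : p.Prime) (torsion : ∀ v : V, ((p : ℤ) ^ M) • v = 0) {s : V}
    {N : ℕ} (hN : ((p : ℤ) ^ N) • s = 0) {a : ℤ} (ha : a • s ≠ 0) :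
    ∃ w : ℤ, ((p : ℤ) ^ (N - 1)) • s = w • (a • s) := by
  have ha0 : a ≠ 0 := by
    rintro rfl
    exact ha (zero_zsmul _)
  obtain ⟨j, β, hβ, rfl⟩ : ∃ j : ℕ, ∃ β : ℤ, ¬ (p : ℤ) ∣ β ∧ a = (p : ℤ) ^ j * β := by
    have hfin : FiniteMultiplicity (p : ℤ) a :=
      Int.finiteMultiplicity_iff.mpr ⟨by rw [Int.natAbs_natCast]; exact hp.one_lt.ne', ha0⟩
    obtain ⟨β, hβ, hnd⟩ := hfin.exists_eq_pow_mul_and_not_dvd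
    exact ⟨multiplicity (p : ℤ) a, β, hnd, hβ⟩
  -- `j < N`, otherwise `a • s = 0`
  have hjN : j < N := by
    by_contra hle
    apply ha
    rw [mul_comm, mul_zsmul, pow_zsmul_eq_zero_of_le (Nat.le_of_not_lt hle) hN, zsmul_zero]
  obtain ⟨u, hu⟩ := exists_mul_zsmul_eq_of_not_dvd hp torsion hβ
  refine ⟨(p : ℤ) ^ (N - 1 - j) * u, ?_⟩
  calc ((p : ℤ) ^ (N - 1)) • s
      = ((p : ℤ) ^ (N - 1 - j)) • (((p : ℤ) ^ j) • s) := by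
        rw [smul_smul, ← pow_add, Nat.sub_add_cancel (by omega)]
    _ = ((p : ℤ) ^ (N - 1 - j)) • ((u * β) • (((p : ℤ) ^ j) • s)) := by rw [hu]
    _ = ((p : ℤ) ^ (N - 1 - j) * u) • (((p : ℤ) ^ j * β) • s) := by
        simp only [smul_smul]
        ring_nf

/-! ## §2 The data (displayed hypotheses = the fields of `HypothesesM` without `hp2`) -/

variable {Pl : Type*} {M₀ δ : ℕ} {τ : V →+ V} {Sel : AddSubgroup V} {Loc : Pl → AddSubgroup V}
  {Kol : ℕ → Prop} {pl : ℕ → Pl} {Dv : Pl → ℕ → Prop} {A : ℕ → AddSubgroup V} {x : V} {ε : ℤ}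
  {c : ℕ → V}

/-! ### Signs and eigenclasses -/

/-- `ε² = 1` for a sign. [folklore] -/
theorem sign_mul_self (hε : ε = 1 ∨ ε = -1) : ε * ε = 1 := by
  rcases hε with h | h <;> simp [h]

/-- `-ε` is a sign. [folklore] -/
theorem neg_sign (hε : ε = 1 ∨ ε = -1) : -ε = 1 ∨ -ε = -1 := by
  rcases hε with h | h <;> simp [h]

/-- `c(ℓ)` lies in the `-ε`-eigenspace (Gross 1991, Prop. 5.4 (2), through the displayed `τ_c`).
[cite: GrossLMS1991, Prop. 5.4 (2)] -/
theorem τ_c_prime (prime_of_kol : ∀ ℓ, Kol ℓ → ℓ.Prime)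
    (τ_c : ∀ n, KolSupp Kol n → τ (c n) = (ε * (-1) ^ n.primeFactors.card) • c n)
    {ℓ : ℕ} (hℓ : Kol ℓ) : τ (c ℓ) = (-ε) • c ℓ := by
  have := τ_c ℓ (kolSupp_prime (prime_of_kol ℓ hℓ) hℓ)
  rwa [Literature.NumberTheory.EllipticCurves.KolyvaginDescent.card_primeFactors_prime
    (prime_of_kol ℓ hℓ), pow_one, mul_neg_one] at this

/-- `c(ℓℓ')` lies in the `ε`-eigenspace for distinct Kolyvagin primes.
[cite: GrossLMS1991, Prop. 5.4 (2)] -/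
theorem τ_c_mul (prime_of_kol : ∀ ℓ, Kol ℓ → ℓ.Prime)
    (τ_c : ∀ n, KolSupp Kol n → τ (c n) = (ε * (-1) ^ n.primeFactors.card) • c n)
    {ℓ ℓ' : ℕ} (hℓ : Kol ℓ) (hℓ' : Kol ℓ') (hne : ℓ ≠ ℓ') : τ (c (ℓ * ℓ')) = ε • c (ℓ * ℓ') := by
  have := τ_c (ℓ * ℓ') (kolSupp_mul (prime_of_kol ℓ hℓ) (prime_of_kol ℓ' hℓ') hne hℓ hℓ')
  rwa [Literature.NumberTheory.EllipticCurves.KolyvaginDescent.card_primeFactors_mul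
    (prime_of_kol ℓ hℓ) (prime_of_kol ℓ' hℓ') hne, even_two.neg_pow, one_pow, mul_one] at this

/-- `c(ℓ)` satisfies the Selmer condition away from `λ` (McCallum Lemma 4.3, displayed `c_mem_loc`).
[cite: McCallumLMS1991, Lemma 4.3] -/
theorem c_mem_loc_of_ne (prime_of_kol : ∀ ℓ, Kol ℓ → ℓ.Prime)
    (dv_iff : ∀ ℓ, Kol ℓ → ∀ v, Dv v ℓ ↔ v = pl ℓ)
    (c_mem_loc : ∀ n, KolSupp Kol n → ∀ v, ¬ Dv v n → c n ∈ Loc v)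
    {ℓ : ℕ} (hℓ : Kol ℓ) {v : Pl} (hv : v ≠ pl ℓ) : c ℓ ∈ Loc v :=
  c_mem_loc ℓ (kolSupp_prime (prime_of_kol ℓ hℓ) hℓ) v fun h ↦ hv ((dv_iff ℓ hℓ v).mp h)

/-- Prop. 4.4 at `n = ℓ`, `m = 1`: `p^a d(ℓ)_λ = 0 ↔ p^a y_λ = 0`, `y = c(1) = p^{M₀} x`
(displayed `c_mem_loc_iff`, `c_one`). [cite: McCallumLMS1991, Prop. 4.4] -/
theorem c_mem_loc_iff_one (prime_of_kol : ∀ ℓ, Kol ℓ → ℓ.Prime)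
    (c_one : c 1 = ((p : ℤ) ^ M₀) • x)
    (c_mem_loc_iff : ∀ ℓ m, Kol ℓ → KolSupp Kol (ℓ * m) → ∀ a : ℕ,
      (((p : ℤ) ^ a) • c (ℓ * m) ∈ Loc (pl ℓ)) ↔ ((p : ℤ) ^ a) • c m ∈ A ℓ)
    {ℓ : ℕ} (hℓ : Kol ℓ) (a : ℕ) :
    (((p : ℤ) ^ a) • c ℓ ∈ Loc (pl ℓ)) ↔ ((p : ℤ) ^ a) • (((p : ℤ) ^ M₀) • x) ∈ A ℓ := by
  have := c_mem_loc_iff ℓ 1 hℓ (by rw [mul_one]; exact kolSupp_prime (prime_of_kol ℓ hℓ) hℓ) a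
  rwa [mul_one, c_one] at this

/-! ### `y = p^{M₀} x` -/

/-- `ord y = p^{M - M₀}` exactly, for `y = p^{M₀} x` and `M₀ < M`: `p^{M-M₀} y = 0` and
`p^{M-M₀-1} y = p^{M-1} x ≠ 0`. [folklore] -/
theorem y_exact (torsion : ∀ v : V, ((p : ℤ) ^ M) • v = 0)
    (x_ord : ((p : ℤ) ^ (M - 1)) • x ≠ 0) (hM₀ : M₀ < M) :
    ((p : ℤ) ^ (M - M₀)) • (((p : ℤ) ^ M₀) • x) = 0 ∧
      ((p : ℤ) ^ (M - M₀ - 1)) • (((p : ℤ) ^ M₀) • x) ≠ 0 := by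
  constructor
  · rw [smul_smul, ← pow_add, Nat.sub_add_cancel hM₀.le, torsion]
  · rw [smul_smul, ← pow_add, show M - M₀ - 1 + M₀ = M - 1 by omega]
    exact x_ord

/-- `τ y = ε y`. [folklore] -/
theorem τ_y (τ_x : τ x = ε • x) : τ (((p : ℤ) ^ M₀) • x) = ε • (((p : ℤ) ^ M₀) • x) := by
  rw [map_zsmul, τ_x, smul_comm]

/-! ## §3 Claim A without parity: `p^{M₀+δ} · Sel^{-ε} = 0` -/

/-- **Claim A, parity-free, with duality defect `δ`: `p^{M₀+δ} s = 0` for every `s ∈ Sel^{-ε}`.**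
Mod-`p^M` Claim 10.1 of Gross 1991 / McCallum §5, as in the tree's `HypothesesM.claimA`, for an
ARBITRARY prime `p`.  The one parity-dependent step there — the independence of the opposite
eigenclasses `y ∈ V^{ε}`, `s ∈ V^{-ε}` fed to Čebotarev — is replaced by a case split: either `ℤy ∩ ℤs = 0`
(then Cor. 3.2 for the pair `{y, s}` as before), or `ℤ y ∩ ℤ s ≠ 0`, in which case the `p`-socles of the
two cyclic groups coincide (`exists_socle_eq_zsmul`, `exists_unit_zsmul_socle`), so that Cor. 3.2 for
the single class `y` (`ord y_λ = ord y`) already forces `ord s_λ = ord s`.  Then `d_M(ℓ)` has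
`ord d_M(ℓ)_λ = p^{M-M₀}` (Prop. 4.4), lies in `V^{-ε}` and is Selmer off `λ` (Lemma 4.3), and the
duality WITH DEFECT `δ` gives `ord s = ord s_λ ≤ p^{M₀+δ}`.
[cite: GrossLMS1991, §10 Claim 10.1] [cite: McCallumLMS1991, §5 (proof of Thm. 5.4), Cor. 3.2, Prop. 4.4, Lemma 5.3] -/
theorem claimA_defect (hp : p.Prime) (torsion : ∀ v : V, ((p : ℤ) ^ M) • v = 0)
    (prime_of_kol : ∀ ℓ, Kol ℓ → ℓ.Prime)
    (dv_iff : ∀ ℓ, Kol ℓ → ∀ v, Dv v ℓ ↔ v = pl ℓ)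
    (x_ord : ((p : ℤ) ^ (M - 1)) • x ≠ 0) (hε : ε = 1 ∨ ε = -1) (τ_x : τ x = ε • x)
    (c_one : c 1 = ((p : ℤ) ^ M₀) • x)
    (τ_c : ∀ n, KolSupp Kol n → τ (c n) = (ε * (-1) ^ n.primeFactors.card) • c n)
    (c_mem_loc : ∀ n, KolSupp Kol n → ∀ v, ¬ Dv v n → c n ∈ Loc v)
    (c_mem_loc_iff : ∀ ℓ m, Kol ℓ → KolSupp Kol (ℓ * m) → ∀ a : ℕ,
      (((p : ℤ) ^ a) • c (ℓ * m) ∈ Loc (pl ℓ)) ↔ ((p : ℤ) ^ a) • c m ∈ A ℓ)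
    (duality : ∀ ℓ, Kol ℓ → ∀ ν : ℤ, (ν = 1 ∨ ν = -1) → ∀ d, τ d = ν • d →
      (∀ v, v ≠ pl ℓ → d ∈ Loc v) → ∀ s ∈ Sel, τ s = ν • s →
      ∀ a, a < M → ((p : ℤ) ^ a) • d ∉ Loc (pl ℓ) → ((p : ℤ) ^ (M - 1 - a + δ)) • s ∈ A ℓ)
    (cebotarev : ∀ (r : ℕ) (cs : Fin r → V) (Nv : Fin r → ℕ), (∀ i, cs i ≠ 0) →
      (∀ i, Nv i ≠ 0 → ((p : ℤ) ^ (Nv i - 1)) • cs i ≠ 0) →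
      (∀ i, ∃ e : ℤ, (e = 1 ∨ e = -1) ∧ τ (cs i) = e • cs i) →
      (∀ a : Fin r → ℤ, ∑ i, a i • cs i = 0 → ∀ i, a i • cs i = 0) →
      ∀ b : ℕ, ∃ ℓ, b < ℓ ∧ Kol ℓ ∧ ∀ i, ((p : ℤ) ^ Nv i) • cs i ∈ A ℓ ∧
        (Nv i ≠ 0 → ((p : ℤ) ^ (Nv i - 1)) • cs i ∉ A ℓ))
    {s : V} (hs : s ∈ Sel) (hτs : τ s = (-ε) • s) :
    ((p : ℤ) ^ (M₀ + δ)) • s = 0 := by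
  rcases Nat.lt_or_ge M₀ M with hM₀ | hM₀
  swap
  · exact pow_zsmul_eq_zero_of_le (by omega) (torsion s)
  obtain ⟨N, -, hN, hNmin⟩ := exists_exact_exponent torsion s
  by_cases hN0 : N = 0
  · subst hN0
    rw [pow_zero, one_zsmul] at hN
    rw [hN, smul_zero]
  -- `y = p^{M₀} x`
  set y : V := ((p : ℤ) ^ M₀) • x with hy
  obtain ⟨hy0, hy1⟩ := y_exact (M₀ := M₀) torsion x_ord hM₀
  have hyne : y ≠ 0 := fun h ↦ hy1 (by rw [← hy, h, smul_zero])
  have hτy : τ y = ε • y := τ_y τ_x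
  have hsne : s ≠ 0 := fun h ↦ hNmin (N - 1) (by omega) (by rw [h, smul_zero])
  have hsN1 : ((p : ℤ) ^ (N - 1)) • s ≠ 0 := hNmin (N - 1) (by omega)
  -- a Kolyvagin prime `ℓ` with `ord y_λ = ord y` and `ord s_λ = ord s`
  obtain ⟨ℓ, hℓ, hyA, hsA⟩ : ∃ ℓ, Kol ℓ ∧ ((p : ℤ) ^ (M - M₀ - 1)) • y ∉ A ℓ ∧
      ((p : ℤ) ^ (N - 1)) • s ∉ A ℓ := by
    by_cases hind : ∀ a₀ a₁ : ℤ, a₀ • y + a₁ • s = 0 → a₀ • y = 0 ∧ a₁ • s = 0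
    · -- independent pair: Cor. 3.2 for `{y, s}`
      obtain ⟨ℓ, -, hℓ, hloc⟩ := cebotarev 2 ![y, s] ![M - M₀, N]
        (fun i ↦ by
          fin_cases i
          · exact hyne
          · exact hsne)
        (fun i ↦ by
          fin_cases i
          · intro _
            exact hy1
          · intro _
            exact hsN1)
        (fun i ↦ by
          fin_cases i
          · exact ⟨ε, hε, hτy⟩
          · exact ⟨-ε, neg_sign hε, hτs⟩)
        (fun a ha i ↦ by
          rw [Fin.sum_univ_two] at ha
          simp only [Matrix.cons_val_zero, Matrix.cons_val_one] at ha
          have := hind _ _ ha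
          fin_cases i
          · exact this.1
          · exact this.2) 0
      refine ⟨ℓ, hℓ, ?_, ?_⟩
      · have := (hloc 0).2 (by simp only [Matrix.cons_val_zero]; omega)
        simpa using this
      · have := (hloc 1).2 (by simpa using hN0)
        simpa using this
    · -- dependent pair: the socles coincide, Cor. 3.2 for `{y}` alone
      push Not at hind
      obtain ⟨a₀, a₁, hrel, hne⟩ := hind
      have ha₁ : a₁ • s ≠ 0 := by
        intro h0
        have h1 : a₀ • y = 0 := by rwa [h0, add_zero] at hrel
        exact hne h1 h0
      -- `p^{N-1} s = w a₁ s = -w a₀ y` is a unit multiple of `p^{M-M₀-1} y`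
      obtain ⟨w, hw⟩ := exists_socle_eq_zsmul hp torsion hN ha₁
      have ht : ((p : ℤ) ^ (N - 1)) • s = (-(w * a₀)) • y := by
        rw [hw, eq_neg_of_add_eq_zero_right hrel, smul_neg, smul_smul, neg_smul]
      have hpt : (p : ℤ) • (((p : ℤ) ^ (N - 1)) • s) = 0 := by
        rw [smul_smul, ← pow_succ', show N - 1 + 1 = N by omega, hN]
      obtain ⟨u, hu, hut⟩ := exists_unit_zsmul_socle hp (k := M - M₀) (by omega) hy0 hy1 ht hsN1 hpt
      obtain ⟨ℓ, -, hℓ, hloc⟩ := cebotarev 1 ![y] ![M - M₀]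
        (fun i ↦ by
          fin_cases i
          exact hyne)
        (fun i ↦ by
          fin_cases i
          intro _
          exact hy1)
        (fun i ↦ by
          fin_cases i
          exact ⟨ε, hε, hτy⟩)
        (fun a ha i ↦ by
          rw [Fin.sum_univ_one] at ha
          fin_cases i
          simpa using ha) 0
      have hyA : ((p : ℤ) ^ (M - M₀ - 1)) • y ∉ A ℓ := by
        have := (hloc 0).2 (by simp only [Matrix.cons_val_zero]; omega)
        simpa using this
      refine ⟨ℓ, hℓ, hyA, fun hmem ↦ hyA ?_⟩
      rw [hut, unit_zsmul_mem_iff hp torsion hu] at hmem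
      exact hmem
  -- `d_M(ℓ)`: `ord d_M(ℓ)_λ = ord y_λ = p^{M - M₀}`, Selmer off `λ`, in the `-ε`-eigenspace
  have h1 : ((p : ℤ) ^ (M - M₀ - 1)) • c ℓ ∉ Loc (pl ℓ) := fun h ↦
    hyA ((c_mem_loc_iff_one prime_of_kol c_one c_mem_loc_iff hℓ _).mp h)
  have hdual := duality ℓ hℓ (-ε) (neg_sign hε) (c ℓ) (τ_c_prime prime_of_kol τ_c hℓ)
    (fun v hv ↦ c_mem_loc_of_ne prime_of_kol dv_iff c_mem_loc hℓ hv) s hs hτs (M - M₀ - 1)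
    (by omega) h1
  rw [show M - 1 - (M - M₀ - 1) + δ = M₀ + δ by omega] at hdual
  -- hence `ord s ≤ p^{M₀ + δ}`
  have hle : N ≤ M₀ + δ := exact_exponent_le_of_mem hdual (fun _ ↦ hsA)
  exact pow_zsmul_eq_zero_of_le hle hN

/-- **`p^{M₀+δ} c(ℓ) = 0` when `x_λ = 0`** (Gross 1991, Prop. 10.2 modulo `p^M`, parity-free): then
`y_λ = 0`, so `d_M(ℓ)_λ = 0` (Prop. 4.4) and `c(ℓ) ∈ Sel^{-ε}`, which `p^{M₀+δ}` kills by Claim A.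
[cite: GrossLMS1991, Prop. 10.2] -/
theorem pow_zsmul_c_eq_zero_defect (hp : p.Prime) (torsion : ∀ v : V, ((p : ℤ) ^ M) • v = 0)
    (mem_sel_iff : ∀ s, s ∈ Sel ↔ ∀ v, s ∈ Loc v)
    (prime_of_kol : ∀ ℓ, Kol ℓ → ℓ.Prime)
    (dv_iff : ∀ ℓ, Kol ℓ → ∀ v, Dv v ℓ ↔ v = pl ℓ)
    (x_ord : ((p : ℤ) ^ (M - 1)) • x ≠ 0) (hε : ε = 1 ∨ ε = -1) (τ_x : τ x = ε • x)
    (c_one : c 1 = ((p : ℤ) ^ M₀) • x)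
    (τ_c : ∀ n, KolSupp Kol n → τ (c n) = (ε * (-1) ^ n.primeFactors.card) • c n)
    (c_mem_loc : ∀ n, KolSupp Kol n → ∀ v, ¬ Dv v n → c n ∈ Loc v)
    (c_mem_loc_iff : ∀ ℓ m, Kol ℓ → KolSupp Kol (ℓ * m) → ∀ a : ℕ,
      (((p : ℤ) ^ a) • c (ℓ * m) ∈ Loc (pl ℓ)) ↔ ((p : ℤ) ^ a) • c m ∈ A ℓ)
    (duality : ∀ ℓ, Kol ℓ → ∀ ν : ℤ, (ν = 1 ∨ ν = -1) → ∀ d, τ d = ν • d →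
      (∀ v, v ≠ pl ℓ → d ∈ Loc v) → ∀ s ∈ Sel, τ s = ν • s →
      ∀ a, a < M → ((p : ℤ) ^ a) • d ∉ Loc (pl ℓ) → ((p : ℤ) ^ (M - 1 - a + δ)) • s ∈ A ℓ)
    (cebotarev : ∀ (r : ℕ) (cs : Fin r → V) (Nv : Fin r → ℕ), (∀ i, cs i ≠ 0) →
      (∀ i, Nv i ≠ 0 → ((p : ℤ) ^ (Nv i - 1)) • cs i ≠ 0) →
      (∀ i, ∃ e : ℤ, (e = 1 ∨ e = -1) ∧ τ (cs i) = e • cs i) →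
      (∀ a : Fin r → ℤ, ∑ i, a i • cs i = 0 → ∀ i, a i • cs i = 0) →
      ∀ b : ℕ, ∃ ℓ, b < ℓ ∧ Kol ℓ ∧ ∀ i, ((p : ℤ) ^ Nv i) • cs i ∈ A ℓ ∧
        (Nv i ≠ 0 → ((p : ℤ) ^ (Nv i - 1)) • cs i ∉ A ℓ))
    {ℓ : ℕ} (hℓ : Kol ℓ) (hx : x ∈ A ℓ) :
    ((p : ℤ) ^ (M₀ + δ)) • c ℓ = 0 := by
  refine claimA_defect hp torsion prime_of_kol dv_iff x_ord hε τ_x c_one τ_c c_mem_loc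
    c_mem_loc_iff duality cebotarev ((mem_sel_iff _).mpr fun v ↦ ?_)
    (τ_c_prime prime_of_kol τ_c hℓ)
  by_cases hv : v = pl ℓ
  · rw [hv]
    have hy : ((p : ℤ) ^ 0) • (((p : ℤ) ^ M₀) • x) ∈ A ℓ := by
      rw [pow_zero, one_zsmul]
      exact (A ℓ).zsmul_mem hx _
    have := (c_mem_loc_iff_one prime_of_kol c_one c_mem_loc_iff hℓ 0).mpr hy
    rwa [pow_zero, one_zsmul] at this
  · exact c_mem_loc_of_ne prime_of_kol dv_iff c_mem_loc hℓ hv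


end Summit.BirchSwinnertonDyer.BirchSwinnertonDyer.Theorems.SylvesterTwoUpper.DescentDefect

end
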